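import Summits.KontsevichZagierPeriods.KontsevichZagierPeriods.Theorems.LinRedNormalFormArrangementNormalFormStubRebaseSimplePosTools

/-!
# Stub `stub_rebaseSimplePos` (crux `ArrangementNormalForm`, line `janus-bands`, v6) — part `Pull`

**The per-fibre affine pull-back** (rule 2 of the Kontsevich–Zagier calculus) for the literal
class text `GG B σ K`, uniformly in the silent base coordinates `x'`: given rational scalings
`μᵢ ≠ 0`, `y`-slopes `αᵢ` and `x'`-affine shifts `δᵢ(x')`, the substitution
`tᵢ = μᵢ sᵢ + αᵢ y + δᵢ(x')` (base unchanged) maps a representation `s` with literal data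
`(M, L, e, p, ℓ₁, ℓ₂, n₁, n₂, a, lo, hi)` to a representation `s'` with literal data of the SAME
shape — rows, `L`, `e`, `ℓ₁`, `ℓ₂`, `n₁`, `n₂` unchanged, `p' = pullQ · p`, letters `pullA`,
bounds `pullLo/pullHi` (an affine bound `c` of `tᵢ` becomes `(c − αᵢ y − δᵢ)/μᵢ`, the two
bounds swap if `μᵢ < 0`; a mutual bound `tⱼ` stays `sⱼ` if the linked fibres carry the same
data) — with `[s] − [s'] ∈ KZ.relations` (`RebasePos.pull`, registered as `rebaseSimplePos_pull`).
Shearing along the letter (`αᵢ` = letter slope) makes the letter `y`-free; `μᵢ`, `δᵢ` rescale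
one `y`-sloped bound to the coordinate `y` itself.

References: M. Kontsevich, D. Zagier, *Periods* (2001), §1.2, rule (2).
-/

noncomputable section

open Set MeasureTheory MvPolynomial
open Literature.NumberTheory.Transcendental Literature.ModelTheory.ExponentialFields

namespace Summit.KontsevichZagierPeriods.ArrangementNormalForm.JanusBands

namespace RebasePos

open SeparatePos

section Pull

variable {B K : ℕ} (μ α : Fin K → ℚ) (δ : Fin K → (Fin B → ℚ) × ℚ)

/-- Sign bookkeeping for `μ > 0`. -/
theorem sgn_pos {c x : ℝ} (h : 0 < c) : (c * x < 0 ↔ x < 0) ∧ (0 < c * x ↔ 0 < x) := by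
  constructor <;> constructor <;> intro h' <;> nlinarith

/-- Sign bookkeeping for `μ < 0`. -/
theorem sgn_neg {c x : ℝ} (h : c < 0) : (c * x < 0 ↔ 0 < x) ∧ (0 < c * x ↔ x < 0) := by
  constructor <;> constructor <;> intro h' <;> nlinarith

/-- Players under `Ψ`, relative to the fibre `i`. -/
theorem pv_pullInv_sub (hμ : ∀ i, μ i ≠ 0) (i : Fin K) (u : Fin K ⊕ ((Fin (B + 1) → ℚ) × ℚ))
    (hu : ∀ j, u = Sum.inl j → μ j = μ i ∧ α j = α i ∧ δ j = δ i) (w : Fin (B + 1 + K) → ℝ) :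
    pv u (pullInv μ α δ w) - pullInv μ α δ w (Fin.natAdd (B + 1) i) =
      (μ i : ℝ) * (pv (u.map id (pullC (μ i) (α i) (δ i))) w - w (Fin.natAdd (B + 1) i)) := by
  rcases u with j | c
  · obtain ⟨h1, h2, h3⟩ := hu j rfl
    simp only [pv, Sum.elim_inl, Sum.map_inl, id, pullInv_fib, h1, h2, h3]
    ring
  · have key := pullInv_fib_sub_affF μ α δ hμ i c w
    simp only [affF] at key
    simp only [pv, Sum.elim_inr, Sum.map_inr, pullInv_base]
    linarith

/-- The letter block under `Ψ`. -/
theorem fib_pullInv (hμ : ∀ i, μ i ≠ 0) (a : Fin K → Option ((Fin (B + 1) → ℚ) × ℚ))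
    (w : Fin (B + 1 + K) → ℝ) :
    fib B K a (pullInv μ α δ w) =
      (∏ i, (a i).elim (1 : ℝ) (fun _ => ((μ i : ℝ))⁻¹)) * fib B K (pullA μ α δ a) w := by
  unfold fib
  rw [← Finset.prod_mul_distrib]
  refine Finset.prod_congr rfl fun i _ => ?_
  rcases h : a i with _ | c
  · simp [pullA, h]
  · have key := pullInv_fib_sub_affF μ α δ hμ i c w
    simp only [affF] at key
    simp only [pullA, h, Option.map_some, Option.elim_some, pullInv_base, one_div]
    rw [key, mul_inv]

/-- The cast of `pullQ`. -/
theorem cast_pullQ (a : Fin K → Option ((Fin (B + 1) → ℚ) × ℚ)) :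
    ((pullQ μ a : ℚ) : ℝ) = (∏ i, (a i).elim (1 : ℝ) (fun _ => ((μ i : ℝ))⁻¹)) * |∏ i, (μ i : ℝ)| := by
  rw [Finset.abs_prod, ← Finset.prod_mul_distrib, pullQ, Rat.cast_prod]
  refine Finset.prod_congr rfl fun i _ => ?_
  rcases a i with _ | c
  · simp
  · simp [mul_comm]

variable {m m' : ℕ}

/-- **The per-fibre affine pull-back** (rule 2). See the module docstring. -/
theorem pull (s : KZ.IntegralRep (B + 1 + K)) (M : Fin m' → (Fin (B + 1) → ℚ) × ℚ)
    (L : Fin m → (Fin B → ℚ) × ℚ) (e : Fin m → ℕ) (p : MvPolynomial (Fin B) ℚ)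
    (ℓ₁ ℓ₂ : (Fin B → ℚ) × ℚ) (n₁ n₂ : ℕ) (a : Fin K → Option ((Fin (B + 1) → ℚ) × ℚ))
    (lo hi : Fin K → Fin K ⊕ ((Fin (B + 1) → ℚ) × ℚ)) (hbd : Bornology.IsBounded s.domain)
    (hdom : s.domain = gDom B K m' M lo hi)
    (hint : EqOn s.integrand (glit B K p L e ℓ₁ ℓ₂ n₁ n₂ a) s.domain)
    (hμ : ∀ i, μ i ≠ 0)
    (hlink : ∀ i j, (lo i = Sum.inl j ∨ hi i = Sum.inl j) → μ i = μ j ∧ α i = α j ∧ δ i = δ j) :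
    ∃ s' : KZ.IntegralRep (B + 1 + K), (∀ w, w ∈ s'.domain ↔ pullInv μ α δ w ∈ s.domain) ∧
      Bornology.IsBounded s'.domain ∧
      s'.domain = gDom B K m' M (pullLo μ α δ lo hi) (pullHi μ α δ lo hi) ∧
      EqOn s'.integrand
        (glit B K (MvPolynomial.C (pullQ μ a) * p) L e ℓ₁ ℓ₂ n₁ n₂ (pullA μ α δ a)) s'.domain ∧
      KZ.of s - KZ.of s' ∈ KZ.relations := by
  set D' : Set (Fin (B + 1 + K) → ℝ) := gDom B K m' M (pullLo μ α δ lo hi) (pullHi μ α δ lo hi)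
    with hD'
  set f' := glit B K (MvPolynomial.C (pullQ μ a) * p) L e ℓ₁ ℓ₂ n₁ n₂ (pullA μ α δ a) with hf'
  -- (1) the new domain is the preimage of the old one under `Ψ`
  have hΨdom : ∀ w, w ∈ D' ↔ pullInv μ α δ w ∈ s.domain := by
    intro w
    rw [hdom]
    have hrow : ∀ j, (∑ i, ((M j).1 i : ℝ) * pullInv μ α δ w (Fin.castAdd K i) + ((M j).2 : ℝ)) =
        ∑ i, ((M j).1 i : ℝ) * w (Fin.castAdd K i) + ((M j).2 : ℝ) := fun j => by
      simp only [pullInv_base]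
    have hfib : ∀ i, (pv (pullLo μ α δ lo hi i) w < w (Fin.natAdd (B + 1) i) ∧
        w (Fin.natAdd (B + 1) i) < pv (pullHi μ α δ lo hi i) w) ↔
        (pv (lo i) (pullInv μ α δ w) < pullInv μ α δ w (Fin.natAdd (B + 1) i) ∧
          pullInv μ α δ w (Fin.natAdd (B + 1) i) < pv (hi i) (pullInv μ α δ w)) := by
      intro i
      have hlo := pv_pullInv_sub μ α δ hμ i (lo i)
        (fun j hj => by obtain ⟨h1, h2, h3⟩ := hlink i j (Or.inl hj); exact ⟨h1.symm, h2.symm, h3.symm⟩) w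
      have hhi := pv_pullInv_sub μ α δ hμ i (hi i)
        (fun j hj => by obtain ⟨h1, h2, h3⟩ := hlink i j (Or.inr hj); exact ⟨h1.symm, h2.symm, h3.symm⟩) w
      rw [← sub_neg (a := pv (lo i) _), ← sub_pos (b := pullInv μ α δ w _), hlo, hhi]
      by_cases hs : 0 < μ i
      · have hs' : (0 : ℝ) < μ i := by exact_mod_cast hs
        simp only [pullLo, pullHi, if_pos hs, (sgn_pos hs').1, (sgn_pos hs').2, sub_neg, sub_pos]
      · have hs' : (μ i : ℝ) < 0 := by exact_mod_cast lt_of_le_of_ne (not_lt.1 hs) (hμ i)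
        simp only [pullLo, pullHi, if_neg hs, (sgn_neg hs').1, (sgn_neg hs').2, sub_neg, sub_pos]
        exact and_comm
    simp only [hD', gDom, mem_setOf_eq, hrow]
    exact and_congr_right fun _ => forall_congr' fun i => hfib i
  -- (2) the new integrand is the old one after substitution times the Jacobian
  have hq : ((pullQ μ a : ℚ) : ℝ) = (∏ i, (a i).elim (1 : ℝ) (fun _ => ((μ i : ℝ))⁻¹)) *
      |∏ i, (μ i : ℝ)| := cast_pullQ μ a
  have hff' : ∀ w, pullInv μ α δ w ∈ s.domain →
      f' w = s.integrand (pullInv μ α δ w) * |∏ i, (μ i : ℝ)| := fun w hw => by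
    rw [hint hw, glit_eq, hf', glit_eq, fib_pullInv μ α δ hμ, map_mul, MvPolynomial.aeval_C,
      eq_ratCast, hq]
    simp only [affB_pullInv, pullInv_base]
    ring
  -- (3) semialgebraicity
  have hD'sa : IsSemialgebraic ℚ D' := isSemialgebraic_gDom m' M _ _
  have hf'sa : IsSemialgebraicFunOn ℚ D' f' := isSemialgebraicFunOn_glit hD'sa _ L e ℓ₁ ℓ₂ n₁ n₂ _
  have hΨsa : IsSemialgebraicMapOn ℚ D' (pullInv μ α δ) :=
    (isSemialgebraicMapOn_aeval hD'sa (pullPoly μ α δ)).congr fun w _ => aeval_pullPoly μ α δ w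
  -- (4) calculus of the substitution
  have hderiv : ∀ w ∈ D', HasFDerivWithinAt (pullInv μ α δ) (pullLin μ α δ) D' w := fun w _ =>
    (hasFDerivAt_pullInv μ α δ w).hasFDerivWithinAt
  have hinj : InjOn (pullInv μ α δ) D' := (pullInv_injective μ α δ hμ).injOn
  have himage : pullInv μ α δ '' D' = s.domain := by
    ext z
    constructor
    · rintro ⟨w, hw, rfl⟩
      exact (hΨdom w).1 hw
    · intro hz
      exact ⟨pullFwd μ α δ z, (hΨdom _).2 (by rw [pullInv_pullFwd μ α δ hμ]; exact hz),
        pullInv_pullFwd μ α δ hμ z⟩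
  have hmeas : MeasurableSet D' := IsSemialgebraic.measurableSet_holds hD'sa
  -- (5) integrability by change of variables
  have hf'int : IntegrableOn f' D' := by
    have h1 : IntegrableOn (fun w => |(pullLin μ α δ).det| • s.integrand (pullInv μ α δ w)) D' :=
      (integrableOn_image_iff_integrableOn_abs_det_fderiv_smul volume hmeas hderiv hinj
        s.integrand).1 (by rw [himage]; exact s.integrableOn)
    refine h1.congr_fun (fun w hw => ?_) hmeas
    show |(pullLin μ α δ).det| • s.integrand (pullInv μ α δ w) = f' w
    rw [smul_eq_mul, pullLin_det, hff' w ((hΨdom w).1 hw), mul_comm]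
  let s' : KZ.IntegralRep (B + 1 + K) := ⟨D', f', hD'sa, hf'sa, hf'int⟩
  have hcov : KZ.of s' - KZ.of s ∈ KZ.relations :=
    KZ.changeOfVariablesRel_subset_relations ⟨B + 1 + K, s', s, pullInv μ α δ, fun _ => pullLin μ α δ,
      hΨsa, hderiv, hinj, himage.symm, fun w hw => by
        show f' w = s.integrand (pullInv μ α δ w) * |(pullLin μ α δ).det|
        rw [pullLin_det]
        exact hff' w ((hΨdom w).1 hw), rfl⟩
  refine ⟨s', hΨdom, ?_, rfl, fun w _ => rfl, ?_⟩
  · show Bornology.IsBounded D'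
    refine (hbd.isCompact_closure.image (continuous_pullFwd μ α δ)).isBounded.subset fun w hw => ?_
    exact ⟨pullInv μ α δ w, subset_closure ((hΨdom w).1 hw), pullFwd_pullInv μ α δ hμ w⟩
  · have := KZ.relations.neg_mem hcov
    rwa [neg_sub] at this

end Pull

end RebasePos

/-- Registered support goal of this file: the per-fibre affine pull-back `RebasePos.pull`. -/
theorem rebaseSimplePos_pull (B K m m' : ℕ) (μ α : Fin K → ℚ) (δ : Fin K → (Fin B → ℚ) × ℚ) (s : KZ.IntegralRep (B + 1 + K)) (M : Fin m' → (Fin (B + 1) → ℚ) × ℚ) (L : Fin m → (Fin B → ℚ) × ℚ) (e : Fin m → ℕ) (p : MvPolynomial (Fin B) ℚ) (ℓ₁ ℓ₂ : (Fin B → ℚ) × ℚ) (n₁ n₂ : ℕ) (a : Fin K → Option ((Fin (B + 1) → ℚ) × ℚ)) (lo hi : Fin K → Fin K ⊕ ((Fin (B + 1) → ℚ) × ℚ)) (hbd : Bornology.IsBounded s.domain) (hdom : s.domain = SeparatePos.gDom B K m' M lo hi) (hint : EqOn s.integrand (RebasePos.glit B K p L e ℓ₁ ℓ₂ n₁ n₂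 a) s.domain) (hμ : ∀ i, μ i ≠ 0) (hlink : ∀ i j, (lo i = Sum.inl j ∨ hi i = Sum.inl j) → μ i = μ j ∧ α i = α j ∧ δ i = δ j) : ∃ s' : KZ.IntegralRep (B + 1 + K), (∀ w, w ∈ s'.domain ↔ RebasePos.pullInv μ α δ w ∈ s.domain) ∧ Bornology.IsBounded s'.domain ∧ s'.domain = SeparatePos.gDom B K m' M (RebasePos.pullLo μ α δ lo hi) (RebasePos.pullHi μ α δ lo hi) ∧ EqOn s'.integrand (RebasePos.glit B K (MvPolynomial.C (RebasePos.pullQ μ a) * p) L e ℓ₁ ℓ₂ n₁ n₂ (RebasePos.pullA μ α δ a)) s'.domain ∧ KZ.of s - KZ.of s' ∈ KZ.relations :=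
  RebasePos.pull μ α δ s M L e p ℓ₁ ℓ₂ n₁ n₂ a lo hi hbd hdom hint hμ hlink

end Summit.KontsevichZagierPeriods.ArrangementNormalForm.JanusBands
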